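import Summits.QuantumFields.YangMills.Theorems.UnitScaleTiltFluctuationComparisonRegPrGlobalSlackKernelLegWeights
import Summits.QuantumFields.YangMills.Theorems.UnitScaleTiltFluctuationComparisonRegPrGlobalSlackCanonicalPolymersMatched
import Literature.MathematicalPhysics.QuantumFieldTheory.Balaban1983to89.B12Decay510Torus
import HarnessLib

/-!
# `UnitScaleTiltFluctuationComparisonRegPrGlobalSlackKernelLegGeometry` — A CONCRETE LEG DISTANCE FOR THE CANONICAL POLYMERISATION: the periodic ℓ¹ distance
# to the level-`b` shadow of the domain; `DistNonneg` and `DistMatched` DISCHARGED (crux `FluctuationComparisonRegPrIntL`, stmt-QuantumFields-20520, STUB 3⁗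
# `stub_globalTwoRunSlackFam`; width-lever lane A; W-slack-2 follow-up)

Seat ym-ust-19935-slack g2 (prover).  The leg-currency line (`…KernelLegEndToEnd.K1aLegRowsP`, `…KernelLegSummableT.K1aLegRowsT`) quantifies a LEG DISTANCE
`dist K b Y c` with two geometry rows, `DistNonneg` and `DistMatched` (refinement-invariance along the bond matching of the two runs).  Here the distance is
DEFINED for the canonical polymerisation and both rows are proved:

* §1 the periodic ℓ¹ distance `pdist x z = Σ_ν |x_ν − z_ν|_T` on the level-`b` torus (`B12Decay510Torus.pabs`/`pl1`): nonnegative, invariant under the level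
  identification `liftSite` of the two runs (`valMinAbs_coordEquiv`: equal moduli, equal labels), and its torus sum `Σ_x e^{−a·pdist x z} ≤ K₁(3,a)`
  (`B12Decay510Torus.sum_exp_pl1_le_K₁`, uniform in the period);
* §2 the level-`b` SHADOW `shadow K b Y` of a set of fine sites (its image under the `b`-fold block map), the ANCHOR SET (the shadow; the origin for the whole
  torus, an empty shadow, or a degenerate level `b > m + K`), and **`canonLegDist F : LegDist F`** = the least `pdist` from the bond's source to the anchor set —
  print's `(M₁Lʲη)⁻¹|c₋ − y|` up to the in-block spread ((43)–(44) pp.266–267);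
* §3 **`canonLegDist_nonneg : DistNonneg (canonLegDist F)`** and **`canonLegDist_matched : DistMatched (canonLegDist F)`** (`shadow_refineSet`: the shadow of the
  refined domain one level up is the `liftSite`-image of the shadow, by `coarsen_succ_eq_liftSite`; `refineSet` fixes the whole torus and only it).
The companion `…KernelLegGeometrySum` bounds the anchor sets of the listed domains and discharges `LegSummableT`.  Pure lattice combinatorics; nothing of
[Balaban1985UV3] is asserted.

References: T. Bałaban, CMP 102 (1985) 255–275 [Balaban1985UV3] ((43)–(45) pp.266–267); CMP 109 (1987) 249–301 [Balaban1987RG1] ((0.1)–(0.3) pp.251–252, (5.10) p.293).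
-/

set_option autoImplicit false

noncomputable section

open scoped BigOperators
open Literature.MathematicalPhysics.QuantumFieldTheory.Balaban1983to89
open Literature.MathematicalPhysics.QuantumFieldTheory.Balaban1983to89.T3ContinuumYM3Torus
open Literature.MathematicalPhysics.QuantumFieldTheory.Balaban1983to89.T3LevelShift
open Literature.MathematicalPhysics.QuantumFieldTheory.Balaban1983to89.T3AlphaInputsAC
open Literature.MathematicalPhysics.QuantumFieldTheory.Balaban1983to89.T3AlphaPolymerSocket
open Literature.MathematicalPhysics.QuantumFieldTheory.Balaban1983to89.B12Decay510Torus (pabs pabs_nonneg pl1 pl1_eq_sum sum_exp_pl1_le_K₁)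
open Literature.MathematicalPhysics.QuantumFieldTheory.Balaban1983to89.B12Decay510Window (K₁ K₁_nonneg)
open Summit.QuantumFields.Balaban3D.Carriers
open Summit.QuantumFields.Balaban3D.Proofs.Primitives
open Summit.QuantumFields.YangMills.Theorems
open Summit.QuantumFields.YangMills.Theorems.GlobalSlackKernelMatching
open Summit.QuantumFields.YangMills.Theorems.GlobalSlackCanonicalPolymers

namespace Summit.QuantumFields.YangMills.Theorems.GlobalSlackKernelLeg

variable {F : T3Family}

/-! ## §1 The periodic ℓ¹ distance on a level and its invariance under the level identification -/

/-- **THE PERIODIC ℓ¹ DISTANCE** of two level-`b` sites of run `K` in lattice units: `Σ_ν |x_ν − z_ν|_T` (minimal representatives; `B12Decay510Torus.pabs`).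
[cite: Balaban1987RG1, (0.1) p.251] -/
def pdist {K b : ℕ} (x z : Site (F.P K) b) : ℝ := ∑ ν : Fin 3, (pabs (x ν - z ν) : ℝ)

/-- `pdist ≥ 0`. [folklore] -/
theorem pdist_nonneg {K b : ℕ} (x z : Site (F.P K) b) : 0 ≤ pdist x z :=
  Finset.sum_nonneg fun ν _ => by exact_mod_cast pabs_nonneg _

/-- `pdist x z` is the periodic ℓ¹ length of `x − z`. [folklore] -/
theorem pdist_eq_pl1 {K b : ℕ} (x z : Site (F.P K) b) : pdist x z = pl1 (d := 3) (fun ν => x ν - z ν) := by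
  rw [pl1_eq_sum]; rfl

/-- Equal moduli, equal labels: the level identification preserves minimal representatives. [cite: Balaban1987RG1, (0.1) p.251] -/
theorem valMinAbs_coordEquiv {m K j m' K' j' : ℕ} (h : (F.PP m K).sitesPerDir j = (F.PP m' K').sitesPerDir j') (u : ZMod ((F.PP m K).sitesPerDir j)) :
    (coordEquiv h u).valMinAbs = u.valMinAbs := by
  rw [ZMod.valMinAbs_def_pos, ZMod.valMinAbs_def_pos, coordEquiv_val, ← h]

/-- Hence it preserves the periodic absolute value. [folklore] -/
theorem pabs_coordEquiv {m K j m' K' j' : ℕ} (h : (F.PP m K).sitesPerDir j = (F.PP m' K').sitesPerDir j') (u : ZMod ((F.PP m K).sitesPerDir j)) :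
    pabs (coordEquiv h u) = pabs u := by
  unfold pabs; rw [valMinAbs_coordEquiv]

/-- **`pdist` IS INVARIANT UNDER THE LEVEL IDENTIFICATION OF THE TWO RUNS** (`liftSite`, level `b` of run `K` ≃ level `b+1` of run `K+1`). [cite: Balaban1987RG1, (0.1) p.251] -/
theorem pdist_liftSite {K b : ℕ} (x z : Site (F.P K) b) : pdist (liftSite F K b x) (liftSite F K b z) = pdist x z := by
  unfold pdist
  refine Finset.sum_congr rfl fun ν _ => ?_
  have hν : liftSite F K b x ν - liftSite F K b z ν =
      coordEquiv (F.sitesPerDir_eq (m := F.m) (K := K) (j := b) (m' := F.m) (K' := K + 1) (j' := b + 1) (by omega)) (x ν - z ν) :=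
    (map_sub (coordEquiv _) (x ν) (z ν)).symm
  exact congrArg (fun t : ℤ => (t : ℝ)) ((congrArg pabs hν).trans (pabs_coordEquiv _ _))

/-- **THE TORUS SUM OF THE LEG DECAY IS UNIFORM IN THE PERIOD**: `Σ_x e^{−a·pdist x z} ≤ K₁(3, a)` (`a > 0`; `B12Decay510Torus.sum_exp_pl1_le_K₁` after `x ↦ x − z`).
[cite: Balaban1987RG1, (5.10) p.293] -/
theorem sum_exp_pdist_le {K b : ℕ} (z : Site (F.P K) b) {a : ℝ} (ha : 0 < a) :
    ∑ x : Site (F.P K) b, Real.exp (-(a * pdist x z)) ≤ K₁ 3 a := by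
  have h := sum_exp_pl1_le_K₁ (d := 3) (N := (F.P K).sitesPerDir b) ha
  refine le_trans (le_of_eq ?_) h
  refine Fintype.sum_equiv (Equiv.subRight z) _ _ fun x => ?_
  rw [pdist_eq_pl1, neg_mul]
  rfl

/-! ## §2 Shadows, anchors, the canonical leg distance -/

open Classical in
/-- THE LEVEL-`b` SHADOW of a set of fine sites of run `K`: its image under the `b`-fold block map `coarsen b`. [cite: Balaban1987RG1, (0.3) p.252] -/
def shadow (K b : ℕ) (Y : Set (Site (F.P K) 0)) : Finset (Site (F.P K) b) :=
  Finset.univ.filter fun z => ∃ x ∈ Y, coarsen b x = z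

/-- Membership in the shadow (definitional). [folklore] -/
theorem mem_shadow {K b : ℕ} {Y : Set (Site (F.P K) 0)} {z : Site (F.P K) b} : z ∈ shadow K b Y ↔ ∃ x ∈ Y, coarsen b x = z := by
  classical
  simp [shadow]

open Classical in
/-- THE ANCHOR SET of a domain at chart index `b`: its level-`b` shadow; the origin for the whole torus, an empty shadow or a degenerate level `b > m + K`
(so that the anchor set is never empty, is a single point off the listed geometry, and is matched across the runs). [cite: Balaban1985UV3, (43) p.266] -/
def anchors (K b : ℕ) (Y : Set (Site (F.P K) 0)) : Finset (Site (F.P K) b) :=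
  if Y = Set.univ ∨ shadow K b Y = ∅ ∨ F.m + K < b then {default} else shadow K b Y

/-- The anchor set is nonempty. [folklore] -/
theorem anchors_nonempty (K b : ℕ) (Y : Set (Site (F.P K) 0)) : (anchors K b Y).Nonempty := by
  classical
  unfold anchors
  split_ifs with h
  · exact Finset.singleton_nonempty _
  · exact Finset.nonempty_iff_ne_empty.mpr fun he => h (Or.inr (Or.inl he))

/-- Off the special cases the anchor set is the shadow. [folklore] -/
theorem anchors_eq_shadow {K b : ℕ} {Y : Set (Site (F.P K) 0)} (hY : Y ≠ Set.univ) (hs : shadow K b Y ≠ ∅) (hb : b ≤ F.m + K) :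
    anchors K b Y = shadow K b Y := by
  classical
  unfold anchors
  rw [if_neg]
  rintro (h | h | h)
  exacts [hY h, hs h, (not_lt.mpr hb) h]

/-- The anchor set is the shadow or the single origin. [folklore] -/
theorem anchors_eq_or (K b : ℕ) (Y : Set (Site (F.P K) 0)) : anchors K b Y = shadow K b Y ∨ anchors K b Y = {default} := by
  classical
  unfold anchors
  split_ifs
  · exact Or.inr rfl
  · exact Or.inl rfl

/-- **THE CANONICAL LEG DISTANCE OF THE CANONICAL POLYMERISATION**: the least periodic ℓ¹ distance (in level-`b` lattice units) from the bond's source to the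
anchor set of the domain — print's `(M₁Lʲη)⁻¹|c₋ − y|` of (43)/(44) up to the in-block spread. [cite: Balaban1985UV3, (43)-(44) pp.266-267] -/
def canonLegDist (F : T3Family) : LegDist F := fun K b Y c =>
  ((anchors K b Y).image fun z => pdist c.src z).min' ((anchors_nonempty K b Y).image _)

/-- The canonical leg distance is attained at an anchor. [folklore] -/
theorem exists_canonLegDist_eq (K b : ℕ) (Y : Set (Site (F.P K) 0)) (c : PBond (F.P K) b) :
    ∃ z ∈ anchors K b Y, canonLegDist F K b Y c = pdist c.src z := by
  have hm := Finset.min'_mem ((anchors K b Y).image fun z => pdist c.src z) ((anchors_nonempty K b Y).image _)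
  obtain ⟨z, hz, hzeq⟩ := Finset.mem_image.mp hm
  exact ⟨z, hz, hzeq.symm⟩

/-- The canonical leg distance is at most the distance to any anchor. [folklore] -/
theorem canonLegDist_le {K b : ℕ} {Y : Set (Site (F.P K) 0)} (c : PBond (F.P K) b) {z : Site (F.P K) b} (hz : z ∈ anchors K b Y) :
    canonLegDist F K b Y c ≤ pdist c.src z :=
  Finset.min'_le _ _ (Finset.mem_image_of_mem _ hz)

/-! ## §3 The two geometry rows, discharged -/

/-- **`DistNonneg (canonLegDist F)`**. [cite: Balaban1985UV3, (44) p.267] -/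
theorem canonLegDist_nonneg (F : T3Family) : DistNonneg (canonLegDist F) := by
  intro K b Y c
  obtain ⟨z, -, hz⟩ := exists_canonLegDist_eq K b Y c
  rw [hz]
  exact pdist_nonneg _ _

/-- `refineSet` fixes the whole torus. [cite: Balaban1987RG1, (0.1) p.251] -/
theorem refineSet_univ (K : ℕ) : refineSet F K (Set.univ : Set (Site (F.P K) 0)) = Set.univ :=
  Set.preimage_univ

/-- … and only it (injectivity). [cite: Balaban1987RG1, (0.1) p.251] -/
theorem refineSet_eq_univ_iff (K : ℕ) (Y : Set (Site (F.P K) 0)) : refineSet F K Y = Set.univ ↔ Y = Set.univ := by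
  constructor
  · intro h
    exact refineSet_injective K (h.trans (refineSet_univ K).symm)
  · rintro rfl; exact refineSet_univ K

/-- The level identification fixes the origin. [folklore] -/
theorem liftSite_default (K b : ℕ) : liftSite F K b (default : Site (F.P K) b) = default := by
  funext ν
  show coordEquiv _ ((default : Site (F.P K) b) ν) = (default : Site (F.P (K + 1)) (b + 1)) ν
  exact map_zero _

/-- **THE SHADOW OF THE REFINED DOMAIN ONE LEVEL UP IS THE LIFTED SHADOW** (`b ≤ m + K`; `coarsen_succ_eq_liftSite`, `coarsenSite` onto).
[cite: Balaban1987RG1, (0.1)-(0.3) pp.251-252] -/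
theorem shadow_refineSet (K b : ℕ) (hb : b ≤ F.m + K) (Y : Set (Site (F.P K) 0)) :
    shadow (K + 1) (b + 1) (refineSet F K Y) = (shadow K b Y).image (liftSite F K b) := by
  classical
  ext z'
  rw [mem_shadow, Finset.mem_image]
  constructor
  · rintro ⟨x', hx', rfl⟩
    refine ⟨coarsen b (coarsenSite F K x'), mem_shadow.mpr ⟨coarsenSite F K x', (mem_refineSet_iff F K Y x').mp hx', rfl⟩, ?_⟩
    exact (coarsen_succ_eq_liftSite K b hb x').symm
  · rintro ⟨z, hz, rfl⟩
    obtain ⟨x, hx, rfl⟩ := mem_shadow.mp hz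
    obtain ⟨x', rfl⟩ := coarsenSite_surjective K x
    exact ⟨x', (mem_refineSet_iff F K Y x').mpr hx, coarsen_succ_eq_liftSite K b hb x'⟩

/-- **THE ANCHOR SETS ARE MATCHED ACROSS THE TWO RUNS**: `anchors (K+1) (b+1) (refineSet Y) = liftSite '' anchors K b Y`. [cite: Balaban1987RG1, (0.1) p.251] -/
theorem anchors_refineSet (K b : ℕ) (Y : Set (Site (F.P K) 0)) :
    anchors (K + 1) (b + 1) (refineSet F K Y) = (anchors K b Y).image (liftSite F K b) := by
  classical
  by_cases hb : F.m + K < b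
  · have hb' : F.m + (K + 1) < b + 1 := by omega
    unfold anchors
    rw [if_pos (Or.inr (Or.inr hb')), if_pos (Or.inr (Or.inr hb)), Finset.image_singleton, liftSite_default]
  · have hb0 : b ≤ F.m + K := not_lt.mp hb
    have hb1 : ¬ F.m + (K + 1) < b + 1 := by omega
    have hsh := shadow_refineSet K b hb0 Y
    have hempty : shadow (K + 1) (b + 1) (refineSet F K Y) = ∅ ↔ shadow K b Y = ∅ := by
      rw [hsh, Finset.image_eq_empty]
    have huniv := refineSet_eq_univ_iff K Y
    unfold anchors
    by_cases hc : Y = Set.univ ∨ shadow K b Y = ∅ ∨ F.m + K < b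
    · have hc' : refineSet F K Y = Set.univ ∨ shadow (K + 1) (b + 1) (refineSet F K Y) = ∅ ∨ F.m + (K + 1) < b + 1 := by
        rcases hc with h | h | h
        · exact Or.inl (huniv.mpr h)
        · exact Or.inr (Or.inl (hempty.mpr h))
        · exact absurd h hb
      rw [if_pos hc', if_pos hc, Finset.image_singleton, liftSite_default]
    · have hc' : ¬ (refineSet F K Y = Set.univ ∨ shadow (K + 1) (b + 1) (refineSet F K Y) = ∅ ∨ F.m + (K + 1) < b + 1) := by
        rintro (h | h | h)
        exacts [hc (Or.inl (huniv.mp h)), hc (Or.inr (Or.inl (hempty.mp h))), hb1 h]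
      rw [if_neg hc', if_neg hc, hsh]

/-- The source of the matched bond is the lifted source (same level identification). [cite: Balaban1987RG1, (0.1) p.251] -/
theorem matchBond_src (K b : ℕ) (c : PBond (F.P K) b) : (matchBond F K b c).src = liftSite F K b c.src := rfl

/-- **`DistMatched (canonLegDist F)`**: the canonical leg distance of the matched bond from the refined domain in run `K+1` equals that of the bond from the domain in
run `K`. [cite: Balaban1987RG1, (0.1) p.251; Balaban1985UV3, (44) p.267] -/
theorem canonLegDist_matched (F : T3Family) : DistMatched (canonLegDist F) := by
  classical
  intro K b Y c
  unfold canonLegDist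
  have hset : ((anchors (K + 1) (b + 1) (refineSet F K Y)).image fun z' => pdist (matchBond F K b c).src z') =
      (anchors K b Y).image fun z => pdist c.src z := by
    rw [anchors_refineSet, Finset.image_image, matchBond_src]
    refine Finset.image_congr fun z _ => ?_
    exact pdist_liftSite c.src z
  simp_rw [hset]

end Summit.QuantumFields.YangMills.Theorems.GlobalSlackKernelLeg

end
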